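import Summits.CriticalPhenomena.PercolationContinuityZ3.Theorems.PercNearOneGluingNoHeavyLowerTailCILConstReduction
import Summits.CriticalPhenomena.PercolationContinuityZ3.Theorems.PercNearOneGluingNoHeavyLowerTailBlockLonelyRelay
import Summits.CriticalPhenomena.PercolationContinuityZ3.Theses.PercNearOneGluingNoHeavy
import HarnessLib

/-!
# `NoHeavyLowerTail` (stmt-CriticalPhenomena-4575) — the AVOIDING-WITNESS bound: a one-line `max`-form
# statement that gives the cumulative isolation lemma with constant `2`, hence the crux (typed reduction),
# and its level-one case (a theorem)

Hull-port prover #4 (prim-hp-4 gen 3, LP-duality line), 2026-08-19.  Bond percolation `μ = prodBernoulli w` on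
`Fin n`, relays `A`, observer `o ∉ A`, `N = |{a ∈ A : o ↔ a}|`, `M_b = |{a ∈ A : b ↔ a}|`, level `j`.

Splitting the lower-tail event `{1 ≤ N ≤ j}` according to whether the observer is joined to a FIXED relay
`a₁` gives `μ(1 ≤ N ≤ j) ≤ μ(M_{a₁} ≤ j) + μ(1 ≤ N ≤ j, o ↮ a₁)` (on `{o ↔ a₁}` one has `M_{a₁} = N`).  Hence the

**avoiding-witness bound** (AW): for every graph, `A`, `o ∉ A`, `j` there are relays `a₁, b ∈ A` with
`μ(1 ≤ N ≤ j, o ↮ a₁) ≤ μ(M_b ≤ j)`,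

implies CIL with constant `2` (`μ(1 ≤ N ≤ j) ≤ 2 · max_a μ(M_a ≤ j)`), and therefore the crux by
`Theorems.noHeavyLowerTail_of_cumulativeIsolationConst_allLevels`.  The sharper `max` form

**(IG₁)**  `μ(1 ≤ N ≤ j, o ↮ a₁) ≤ max_{b ∈ A ∖ a₁} μ(b ↮ a₁, M_b ≤ j)`   (for some / every `a₁ ∈ A`)

implies (AW) trivially (`avoidingWitness_of_avoidingMax`).  (IG₁) holds with NO counterexample in an exact
brute-force census (23 000+ instances `(G, A, o, a₁, j)`, `n ≤ 7`, all `a₁`; seat memo HULLPORT-LP-gen3.md), is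
sharp exactly at glue (`o` joined to a relay by a weight-one edge), and is the `G`-level shadow of the seat's
per-world LP certificates (A-singleton rows with constant `2`).  At level `j = 1` it IS a theorem — the block
lonely relay lemma with the singleton blocks `{b}`, `b ≠ a₁` (`avoidingMax_levelOne`): Kozma–Nitzan Lemma 2.

Contents: `lowerTail_le_add_avoiding` (the split), `cumulativeIsolationTwo_of_avoidingWitness`,
`noHeavyLowerTail_of_avoidingWitness` (+ the sibling-route copy), `avoidingWitness_of_avoidingMax`,
`noHeavyLowerTail_of_avoidingMax`, `avoidingMax_levelOne`.  No definitions, no sorries, standard axioms.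
-/

noncomputable section

namespace Summit.CriticalPhenomena.PercolationContinuityZ3.Theorems

open MeasureTheory Set Literature.Probability.LatticeModels Literature.Probability.Percolation
open scoped Classical BigOperators

namespace AvoidingWitness

variable {n : ℕ}

/-- **The split at a fixed relay.**  For `a₁ ∈ A`:
`μ(1 ≤ N ≤ j) ≤ μ(M_{a₁} ≤ j) + μ(1 ≤ N ≤ j, o ↮ a₁)` — on `{o ↔ a₁}` the clusters of `o` and `a₁` coincide,
so `M_{a₁} = N ≤ j`. [this work] -/
theorem lowerTail_le_add_avoiding (w : Sym2 (Fin n) → unitInterval) (A : Finset (Fin n)) (o a₁ : Fin n)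
    (j : ℕ) :
    (prodBernoulli w).real {ω : BondConfig (Fin n) |
        1 ≤ (A.filter fun x => ω ∈ openConn o x).card ∧ (A.filter fun x => ω ∈ openConn o x).card ≤ j} ≤
      (prodBernoulli w).real {ω : BondConfig (Fin n) | (A.filter fun x => ω ∈ openConn a₁ x).card ≤ j} +
        (prodBernoulli w).real {ω : BondConfig (Fin n) |
          1 ≤ (A.filter fun x => ω ∈ openConn o x).card ∧ (A.filter fun x => ω ∈ openConn o x).card ≤ j ∧
            ω ∉ openConn o a₁} := by
  set μ := prodBernoulli w with hμ
  have hsub : {ω : BondConfig (Fin n) |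
        1 ≤ (A.filter fun x => ω ∈ openConn o x).card ∧ (A.filter fun x => ω ∈ openConn o x).card ≤ j} ⊆
      {ω : BondConfig (Fin n) | (A.filter fun x => ω ∈ openConn a₁ x).card ≤ j} ∪
        {ω : BondConfig (Fin n) |
          1 ≤ (A.filter fun x => ω ∈ openConn o x).card ∧ (A.filter fun x => ω ∈ openConn o x).card ≤ j ∧
            ω ∉ openConn o a₁} := by
    intro ω hω
    simp only [mem_setOf_eq] at hω
    by_cases h : ω ∈ openConn o a₁
    · left
      simp only [mem_setOf_eq]
      have hoa : (openGraph ω).Reachable o a₁ := h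
      have heq : (A.filter fun x => ω ∈ openConn a₁ x) = (A.filter fun x => ω ∈ openConn o x) := by
        apply Finset.filter_congr
        intro x _
        constructor
        · intro hx
          have hx' : (openGraph ω).Reachable a₁ x := hx
          exact (hoa.trans hx' : (openGraph ω).Reachable o x)
        · intro hx
          have hx' : (openGraph ω).Reachable o x := hx
          exact (hoa.symm.trans hx' : (openGraph ω).Reachable a₁ x)
      rw [heq]; exact hω.2
    · right
      simp only [mem_setOf_eq]
      exact ⟨hω.1, hω.2, h⟩
  calc μ.real {ω : BondConfig (Fin n) |
        1 ≤ (A.filter fun x => ω ∈ openConn o x).card ∧ (A.filter fun x => ω ∈ openConn o x).card ≤ j}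
      ≤ μ.real ({ω : BondConfig (Fin n) | (A.filter fun x => ω ∈ openConn a₁ x).card ≤ j} ∪
          {ω : BondConfig (Fin n) |
            1 ≤ (A.filter fun x => ω ∈ openConn o x).card ∧ (A.filter fun x => ω ∈ openConn o x).card ≤ j ∧
              ω ∉ openConn o a₁}) := measureReal_mono hsub (measure_ne_top μ _)
    _ ≤ _ := measureReal_union_le _ _

end AvoidingWitness

open AvoidingWitness

variable {n : ℕ}

/-- **The avoiding-witness bound gives the cumulative isolation lemma with constant `2`.**  If every instance
admits relays `a₁, b ∈ A` with `μ(1 ≤ N ≤ j, o ↮ a₁) ≤ μ(M_b ≤ j)`, then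
`μ(1 ≤ N ≤ j) ≤ 2 · μ(M_a ≤ j)` for some `a ∈ A` (namely the better of `a₁, b`). [this work] -/
theorem cumulativeIsolationTwo_of_avoidingWitness
    (hAW : ∀ (n : ℕ) (w : Sym2 (Fin n) → unitInterval) (A : Finset (Fin n)) (o : Fin n) (j : ℕ),
      A.Nonempty → o ∉ A → ∃ a₁ ∈ A, ∃ b ∈ A,
        (prodBernoulli w).real {ω : BondConfig (Fin n) |
            1 ≤ (A.filter fun x => ω ∈ openConn o x).card ∧ (A.filter fun x => ω ∈ openConn o x).card ≤ j ∧
              ω ∉ openConn o a₁} ≤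
          (prodBernoulli w).real {ω : BondConfig (Fin n) | (A.filter fun x => ω ∈ openConn b x).card ≤ j}) :
    ∀ (n : ℕ) (w : Sym2 (Fin n) → unitInterval) (A : Finset (Fin n)) (o : Fin n) (j : ℕ),
      A.Nonempty → o ∉ A → ∃ a ∈ A,
        (prodBernoulli w).real {ω : BondConfig (Fin n) |
            1 ≤ (A.filter fun x => ω ∈ openConn o x).card ∧
              (A.filter fun x => ω ∈ openConn o x).card ≤ j} ≤
          2 * (prodBernoulli w).real {ω : BondConfig (Fin n) |
            (A.filter fun x => ω ∈ openConn a x).card ≤ j} := by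
  intro n w A o j hA ho
  obtain ⟨a₁, ha₁, b, hb, hle⟩ := hAW n w A o j hA ho
  set μ := prodBernoulli w with hμ
  set ra := μ.real {ω : BondConfig (Fin n) | (A.filter fun x => ω ∈ openConn a₁ x).card ≤ j} with hra
  set rb := μ.real {ω : BondConfig (Fin n) | (A.filter fun x => ω ∈ openConn b x).card ≤ j} with hrb
  have hsplit := lowerTail_le_add_avoiding w A o a₁ j
  by_cases hcmp : rb ≤ ra
  · refine ⟨a₁, ha₁, ?_⟩
    calc μ.real {ω : BondConfig (Fin n) |
          1 ≤ (A.filter fun x => ω ∈ openConn o x).card ∧ (A.filter fun x => ω ∈ openConn o x).card ≤ j}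
        ≤ ra + rb := le_trans hsplit (by linarith)
      _ ≤ 2 * ra := by linarith
  · refine ⟨b, hb, ?_⟩
    have hlt : ra ≤ rb := le_of_lt (lt_of_not_ge hcmp)
    calc μ.real {ω : BondConfig (Fin n) |
          1 ≤ (A.filter fun x => ω ∈ openConn o x).card ∧ (A.filter fun x => ω ∈ openConn o x).card ≤ j}
        ≤ ra + rb := le_trans hsplit (by linarith)
      _ ≤ 2 * rb := by linarith

/-- **The avoiding-witness bound closes the crux** (via CIL with constant `2` and
`Theorems.noHeavyLowerTail_of_cumulativeIsolationConst_allLevels`). [this work] -/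
theorem noHeavyLowerTail_of_avoidingWitness
    (hAW : ∀ (n : ℕ) (w : Sym2 (Fin n) → unitInterval) (A : Finset (Fin n)) (o : Fin n) (j : ℕ),
      A.Nonempty → o ∉ A → ∃ a₁ ∈ A, ∃ b ∈ A,
        (prodBernoulli w).real {ω : BondConfig (Fin n) |
            1 ≤ (A.filter fun x => ω ∈ openConn o x).card ∧ (A.filter fun x => ω ∈ openConn o x).card ≤ j ∧
              ω ∉ openConn o a₁} ≤
          (prodBernoulli w).real {ω : BondConfig (Fin n) | (A.filter fun x => ω ∈ openConn b x).card ≤ j}) :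
    Summit.CriticalPhenomena.PercolationContinuityZ3.Theses.PercNearOneGluing.NoHeavyLowerTail :=
  noHeavyLowerTail_of_cumulativeIsolationConst_allLevels 2 (by norm_num)
    (cumulativeIsolationTwo_of_avoidingWitness hAW)

/-- Same, typed against the sibling route `PercNearOneGluingNoHeavy` (crux stmt-CriticalPhenomena-4575). [this work] -/
theorem noHeavyLowerTail_noHeavy_of_avoidingWitness
    (hAW : ∀ (n : ℕ) (w : Sym2 (Fin n) → unitInterval) (A : Finset (Fin n)) (o : Fin n) (j : ℕ),
      A.Nonempty → o ∉ A → ∃ a₁ ∈ A, ∃ b ∈ A,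
        (prodBernoulli w).real {ω : BondConfig (Fin n) |
            1 ≤ (A.filter fun x => ω ∈ openConn o x).card ∧ (A.filter fun x => ω ∈ openConn o x).card ≤ j ∧
              ω ∉ openConn o a₁} ≤
          (prodBernoulli w).real {ω : BondConfig (Fin n) | (A.filter fun x => ω ∈ openConn b x).card ≤ j}) :
    Summit.CriticalPhenomena.PercolationContinuityZ3.Theses.PercNearOneGluingNoHeavy.NoHeavyLowerTail :=
  noHeavyLowerTail_of_avoidingWitness hAW

/-- **(IG₁) ⇒ (AW).**  The `max` form with avoidance on the right — for some `a₁ ∈ A` and some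
`b ∈ A ∖ a₁`, `μ(1 ≤ N ≤ j, o ↮ a₁) ≤ μ(b ↮ a₁, M_b ≤ j)` — implies the avoiding-witness bound (drop
`b ↮ a₁`).  For `|A| = 1` (AW) is trivial with `a₁ = b =` the relay. [this work] -/
theorem avoidingWitness_of_avoidingMax
    (hIG : ∀ (n : ℕ) (w : Sym2 (Fin n) → unitInterval) (A : Finset (Fin n)) (o : Fin n) (j : ℕ),
      2 ≤ A.card → o ∉ A → ∃ a₁ ∈ A, ∃ b ∈ A.erase a₁,
        (prodBernoulli w).real {ω : BondConfig (Fin n) |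
            1 ≤ (A.filter fun x => ω ∈ openConn o x).card ∧ (A.filter fun x => ω ∈ openConn o x).card ≤ j ∧
              ω ∉ openConn o a₁} ≤
          (prodBernoulli w).real {ω : BondConfig (Fin n) |
            ω ∉ openConn b a₁ ∧ (A.filter fun x => ω ∈ openConn b x).card ≤ j}) :
    ∀ (n : ℕ) (w : Sym2 (Fin n) → unitInterval) (A : Finset (Fin n)) (o : Fin n) (j : ℕ),
      A.Nonempty → o ∉ A → ∃ a₁ ∈ A, ∃ b ∈ A,
        (prodBernoulli w).real {ω : BondConfig (Fin n) |
            1 ≤ (A.filter fun x => ω ∈ openConn o x).card ∧ (A.filter fun x => ω ∈ openConn o x).card ≤ j ∧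
              ω ∉ openConn o a₁} ≤
          (prodBernoulli w).real {ω : BondConfig (Fin n) | (A.filter fun x => ω ∈ openConn b x).card ≤ j} := by
  intro n w A o j hA ho
  set μ := prodBernoulli w with hμ
  by_cases h2 : 2 ≤ A.card
  · obtain ⟨a₁, ha₁, b, hb, hle⟩ := hIG n w A o j h2 ho
    refine ⟨a₁, ha₁, b, Finset.mem_of_mem_erase hb, le_trans hle (measureReal_mono ?_ (measure_ne_top μ _))⟩
    intro ω hω
    exact hω.2
  · -- `|A| = 1`: the avoiding event is empty
    obtain ⟨a₁, ha₁⟩ := hA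
    have hcard : A.card = 1 := by
      have h1 : 1 ≤ A.card := Finset.card_pos.2 ⟨a₁, ha₁⟩
      omega
    obtain ⟨a, hAeq⟩ := Finset.card_eq_one.1 hcard
    have ha₁a : a₁ = a := by rw [hAeq] at ha₁; exact Finset.mem_singleton.1 ha₁
    refine ⟨a₁, ha₁, a₁, ha₁, ?_⟩
    have hempty : {ω : BondConfig (Fin n) |
        1 ≤ (A.filter fun x => ω ∈ openConn o x).card ∧ (A.filter fun x => ω ∈ openConn o x).card ≤ j ∧
          ω ∉ openConn o a₁} = ∅ := by
      ext ω
      simp only [mem_setOf_eq, mem_empty_iff_false, iff_false, not_and, not_not]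
      intro h1 _
      obtain ⟨x, hx⟩ := Finset.card_pos.1 h1
      obtain ⟨hxA, hox⟩ := Finset.mem_filter.1 hx
      have hxa : x = a := by rw [hAeq] at hxA; exact Finset.mem_singleton.1 hxA
      rw [ha₁a, ← hxa]; exact hox
    rw [hempty, measureReal_empty]
    exact measureReal_nonneg

/-- **(IG₁) closes the crux.** [this work] -/
theorem noHeavyLowerTail_of_avoidingMax
    (hIG : ∀ (n : ℕ) (w : Sym2 (Fin n) → unitInterval) (A : Finset (Fin n)) (o : Fin n) (j : ℕ),
      2 ≤ A.card → o ∉ A → ∃ a₁ ∈ A, ∃ b ∈ A.erase a₁,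
        (prodBernoulli w).real {ω : BondConfig (Fin n) |
            1 ≤ (A.filter fun x => ω ∈ openConn o x).card ∧ (A.filter fun x => ω ∈ openConn o x).card ≤ j ∧
              ω ∉ openConn o a₁} ≤
          (prodBernoulli w).real {ω : BondConfig (Fin n) |
            ω ∉ openConn b a₁ ∧ (A.filter fun x => ω ∈ openConn b x).card ≤ j}) :
    Summit.CriticalPhenomena.PercolationContinuityZ3.Theses.PercNearOneGluingNoHeavy.NoHeavyLowerTail :=
  noHeavyLowerTail_of_avoidingWitness (avoidingWitness_of_avoidingMax hIG)

/-- **(IG₁) at level `j = 1` is a theorem**, for EVERY `a₁ ∈ A` (`|A| ≥ 2`): with `b` a relay of `A ∖ a₁`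
maximising `μ(b ↮ A ∖ b)`,  `μ(N = 1, o ↮ a₁) ≤ μ(b ↮ A ∖ b) ≤ μ(b ↮ a₁, M_b ≤ 1)`.  The first inequality is
the block lonely relay lemma (`Theorems.disjointClusters_sum_le`, Kozma–Nitzan Lemma 2) for the singleton blocks
`{b}`, `b ∈ A ∖ a₁`: on `{N = 1, o ↮ a₁}` the captured relay set is one of them.
[cite: KozmaNitzan2024, Lemma 2 (p. 6) — corollary] -/
theorem avoidingMax_levelOne (w : Sym2 (Fin n) → unitInterval) (A : Finset (Fin n)) (o a₁ : Fin n)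
    (ha₁ : a₁ ∈ A) (h2 : 2 ≤ A.card) :
    ∃ b ∈ A.erase a₁,
      (prodBernoulli w).real {ω : BondConfig (Fin n) |
          1 ≤ (A.filter fun x => ω ∈ openConn o x).card ∧ (A.filter fun x => ω ∈ openConn o x).card ≤ 1 ∧
            ω ∉ openConn o a₁} ≤
        (prodBernoulli w).real {ω : BondConfig (Fin n) |
          ω ∉ openConn b a₁ ∧ (A.filter fun x => ω ∈ openConn b x).card ≤ 1} := by
  set μ := prodBernoulli w with hμ
  -- the isolation probabilities and a maximiser over `A \ a₁`
  set q : Fin n → ℝ := fun b => μ.real {ω : BondConfig (Fin n) | ∀ a ∈ A \ {b}, ω ∉ openConn b a} with hq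
  have hne : (A.erase a₁).Nonempty := by
    rw [← Finset.card_pos, Finset.card_erase_of_mem ha₁]; omega
  obtain ⟨b, hb, hbmax⟩ := Finset.exists_max_image (A.erase a₁) q hne
  refine ⟨b, hb, ?_⟩
  obtain ⟨hba₁, hbA⟩ := Finset.mem_erase.1 hb
  -- (1) cover by the singleton capture events
  have hcover : {ω : BondConfig (Fin n) |
        1 ≤ (A.filter fun x => ω ∈ openConn o x).card ∧ (A.filter fun x => ω ∈ openConn o x).card ≤ 1 ∧
          ω ∉ openConn o a₁} ⊆
      ⋃ b' ∈ A.erase a₁, {ω : BondConfig (Fin n) | ∀ a ∈ A, ω ∈ openConn o a ↔ a ∈ ({b'} : Finset (Fin n))} := by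
    intro ω hω
    simp only [mem_setOf_eq] at hω
    obtain ⟨h1, h2', hna⟩ := hω
    have hcard : (A.filter fun x => ω ∈ openConn o x).card = 1 := le_antisymm h2' h1
    obtain ⟨b', hb'⟩ := Finset.card_eq_one.1 hcard
    have hb'f : b' ∈ A.filter fun x => ω ∈ openConn o x := by rw [hb']; exact Finset.mem_singleton_self b'
    obtain ⟨hb'A, hob'⟩ := Finset.mem_filter.1 hb'f
    have hb'ne : b' ≠ a₁ := by rintro rfl; exact hna hob'
    refine mem_iUnion₂.2 ⟨b', Finset.mem_erase.2 ⟨hb'ne, hb'A⟩, ?_⟩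
    simp only [mem_setOf_eq, Finset.mem_singleton]
    intro a haA
    constructor
    · intro hoa
      have : a ∈ A.filter fun x => ω ∈ openConn o x := Finset.mem_filter.2 ⟨haA, hoa⟩
      rw [hb'] at this; exact Finset.mem_singleton.1 this
    · rintro rfl; exact hob'
  -- (2) the block lonely relay lemma for the singletons `{b'}`, `b' ∈ A \ a₁`
  set 𝓑 : Finset (Finset (Fin n)) := (A.erase a₁).image fun b' => ({b'} : Finset (Fin n)) with h𝓑
  have hsub : ∀ B ∈ 𝓑, B ⊆ A := by
    intro B hB
    obtain ⟨b', hb', rfl⟩ := Finset.mem_image.1 hB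
    exact Finset.singleton_subset_iff.2 (Finset.mem_of_mem_erase hb')
  have hneB : ∀ B ∈ 𝓑, B.Nonempty := by
    intro B hB
    obtain ⟨b', _, rfl⟩ := Finset.mem_image.1 hB
    exact Finset.singleton_nonempty b'
  have hdisj : ∀ B' ∈ 𝓑, ∀ B'' ∈ 𝓑, B' ≠ B'' → Disjoint B' B'' := by
    intro B' hB' B'' hB'' hne'
    obtain ⟨x, _, rfl⟩ := Finset.mem_image.1 hB'
    obtain ⟨y, _, rfl⟩ := Finset.mem_image.1 hB''
    rw [Finset.disjoint_singleton_left, Finset.mem_singleton]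
    intro hxy; exact hne' (by rw [hxy])
  have hqB : ∀ B ∈ 𝓑, μ.real {ω : BondConfig (Fin n) | ∀ b' ∈ B, ∀ a ∈ A \ B, ω ∉ openConn b' a} ≤ q b := by
    intro B hB
    obtain ⟨b', hb', rfl⟩ := Finset.mem_image.1 hB
    have hqb' : μ.real {ω : BondConfig (Fin n) | ∀ x ∈ ({b'} : Finset (Fin n)), ∀ a ∈ A \ {b'}, ω ∉ openConn x a}
        = q b' := by
      simp only [hq, Finset.mem_singleton, forall_eq]
    rw [hqb']
    exact hbmax b' hb'
  have hq0 : 0 ≤ q b := measureReal_nonneg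
  have hsum := disjointClusters_sum_le w A o 𝓑 hsub hneB hdisj (q b) hq0 hqB
  -- (3) assemble: μ(cover) ≤ Σ ≤ q b ≤ μ(b ↮ a₁, M_b ≤ 1)
  have hstep1 : μ.real {ω : BondConfig (Fin n) |
        1 ≤ (A.filter fun x => ω ∈ openConn o x).card ∧ (A.filter fun x => ω ∈ openConn o x).card ≤ 1 ∧
          ω ∉ openConn o a₁} ≤
      ∑ B ∈ 𝓑, μ.real {ω : BondConfig (Fin n) | ∀ a ∈ A, ω ∈ openConn o a ↔ a ∈ B} := by
    calc μ.real {ω : BondConfig (Fin n) |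
          1 ≤ (A.filter fun x => ω ∈ openConn o x).card ∧ (A.filter fun x => ω ∈ openConn o x).card ≤ 1 ∧
            ω ∉ openConn o a₁}
        ≤ μ.real (⋃ b' ∈ A.erase a₁,
            {ω : BondConfig (Fin n) | ∀ a ∈ A, ω ∈ openConn o a ↔ a ∈ ({b'} : Finset (Fin n))}) :=
          measureReal_mono hcover (measure_ne_top μ _)
      _ ≤ ∑ b' ∈ A.erase a₁,
            μ.real {ω : BondConfig (Fin n) | ∀ a ∈ A, ω ∈ openConn o a ↔ a ∈ ({b'} : Finset (Fin n))} :=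
          measureReal_biUnion_finset_le _ _
      _ = ∑ B ∈ 𝓑, μ.real {ω : BondConfig (Fin n) | ∀ a ∈ A, ω ∈ openConn o a ↔ a ∈ B} := by
          rw [h𝓑, Finset.sum_image]
          intro x _ y _ hxy
          exact Finset.singleton_injective hxy
  have hstep3 : q b ≤ μ.real {ω : BondConfig (Fin n) |
      ω ∉ openConn b a₁ ∧ (A.filter fun x => ω ∈ openConn b x).card ≤ 1} := by
    refine measureReal_mono ?_ (measure_ne_top μ _)
    intro ω hω
    simp only [mem_setOf_eq] at hω ⊢
    have ha₁' : a₁ ∈ A \ {b} := Finset.mem_sdiff.2 ⟨ha₁, by rw [Finset.mem_singleton]; exact fun h => hba₁ h.symm⟩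
    refine ⟨hω a₁ ha₁', ?_⟩
    have hsubset : (A.filter fun x => ω ∈ openConn b x) ⊆ {b} := by
      intro x hx
      obtain ⟨hxA, hbx⟩ := Finset.mem_filter.1 hx
      rw [Finset.mem_singleton]
      by_contra hxb
      exact hω x (Finset.mem_sdiff.2 ⟨hxA, by rw [Finset.mem_singleton]; exact hxb⟩) hbx
    calc (A.filter fun x => ω ∈ openConn b x).card ≤ ({b} : Finset (Fin n)).card := Finset.card_le_card hsubset
      _ = 1 := Finset.card_singleton b
  linarith

end Summit.CriticalPhenomena.PercolationContinuityZ3.Theorems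

end
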